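import Literature.NumberTheory.Automorphic.Liu2021.AppendixC.BettiPinningLevelDescent
import Literature.NumberTheory.Automorphic.HeckeGelfandTrick
import HarnessLib

/-!
# [Liu 2021, §4.2 l. 2074 «the Hecke correspondences provide a homomorphism `𝔾(𝔸_F^∞) → Aut_E(A_∞)`»] the Hecke OPERATOR `[KgK]` of a pinned
# Betti tower at level `K` is the pull-back of an HONEST endomorphism of `A_K`, up to a non-zero integer — from descent up to isogeny (row (D))

Topic `NumberTheory/Automorphic/Liu2021/AppendixC`; namespace `Literature.NumberTheory.Automorphic.Liu2021.AppendixC`.  THEOREMS ONLY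
(no definition, no named fact, no instance, no `sorry`).  Sibling of `BettiPinningLevelDescent` (same inputs: the hypothesis structure
`Sec42Data.BettiPinning C T τ' H rhoB`, row (D) `HeckeTranslates.IsogenyDescent`, `C5.SmallLevel.exists_normal_le`, the translates' calculus
`albTr_mul / albTr_self / albTr_one`, and additivity of `f ↦ f^*` on `H¹`), and of the tree's Hecke-operator kit (`heckeOperator ρ K g =
Σ_{yK ⊆ KgK} ρ(y)`, `heckeOperator_apply_eq_sum_out`, `finite_orbit_quotient`, `isHeckeTriple_top_of_isCompact_isOpen`).  Written for LINE T5′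
of the cell `hodgecm-mathlib` (D-0151; «CM-Albanese road»): with it the Hecke operators on `H^K = H¹_{B,τ'}(A_K, ℂ)` are pull-backs of
endomorphisms of the abelian variety `A_K`, so Milne's multiplicity-one lever (`HodgeTheory.isOfCMType_of_forall_commute_pullbackOne_comm`)
applies to `A_K ×_{τ'} ℂ`.

## What is proved (generic over `C`, `T`, a pinning `B`, `hD : T.IsogenyDescent`)

* §1 `albTr_eq_of_coe_eq` — `Alb(T_γ) : A_N → A_K` depends on `γ` only through the coset `γK` (`Alb(T_{γκ}) = Alb(T_γ) ≫ Alb(T_κ) = Alb(T_γ)`,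
  `κ ∈ K`); `exists_le_forall_heckeLE` — a level `N ⊆ K` normalised by `K` that is an admissible source for every `T_γ`, `γK ⊆ KgK`
  (finitely many cosets: `K` compact open ⇒ `(K, G)` is a Hecke pair).
* §2 **`exists_hom_b_bettiPullAlong_eq_smul_heckeOperator`** — for every small level `K` and `g ∈ 𝔾(𝔸_F^∞)` there are an integer `m ≠ 0` and an
  HONEST endomorphism `ψ : A_K ⟶ A_K` (over `E`) with `b_K (ψ^* y) = m • [KgK] (b_K y)` for all `y ∈ H¹_{B,τ'}(A_K, ℂ)`: the `K`-invariant
  homomorphism `Φ_g := Σ_{γK ⊆ KgK} Alb(T_γ) : A_N → A_K` descends (row (D)) to `ψ` with `Alb_{u^N_K} ≫ ψ = m • Φ_g`, and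
  `b_N ∘ Alb(T_γ)^* = rhoB γ ∘ b_K` (the Hecke law of the pinning) sums to `[KgK] ∘ b_K`.

HC_CM is proved only modulo the 7 printed citations until rung 0 closes; this file is unconditional and discharges none of them.

## References
* [Liu2021] Y. Liu, Camb. J. Math. 9 (2021) = arXiv:2102.11518: §4.2 (FJcycle.tex l. 2070–2081, esp. l. 2074), Thm. 4.18 (1) with proof
  (l. 2239, l. 2274–2282), Lem. 2.4 (1).
* [Milne2005ShimuraVarieties] J. Milne, *Introduction to Shimura varieties*, §13 p. 118 (the translates `T(g)`), §5 p. 58 (their composition).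
* [Bump1997] D. Bump, *Automorphic Forms and Representations* (1997), §4.2 (the Hecke operator `[KgK]` as a sum over `KgK/K`).
-/

noncomputable section

open CategoryTheory NumberField Function MulAction
open scoped TensorProduct

namespace Literature.NumberTheory.Automorphic.Liu2021.AppendixC

open Literature.AlgebraicGeometry.Motives (AbelianVariety)

variable {F E : Type} [Field F] [NumberField F] [IsTotallyReal F] [Field E] [NumberField E] [Algebra F E]
  [IsTotallyComplex E] [Algebra.IsQuadraticExtension F E]
variable {P5 : PropC5Data F E} {isotropicAt : ℕ → Prop}

/-! ## §1 `Alb(T_γ)` on cosets, and a common admissible normal source level for the cosets of `KgK` -/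

namespace Sec42Data.HeckeTranslates

variable {C : Sec42Data P5 isotropicAt} (T : C.HeckeTranslates)

/-- **`Alb(T_γ) : A_N → A_K` depends on `γ` only through the left coset `γK`**: for `γ' = γκ` with `κ ∈ K`, `Alb(T_{γκ}) = Alb(T_γ) ≫ Alb(T_κ)
= Alb(T_γ)` (`albTr_mul`, `albTr_self`). [cite: Milne2005ShimuraVarieties, §5 p. 58 L6–11 and §13 p. 118 L21–26] [cite: Liu2021, §4.2 l. 2070–2074] -/
theorem albTr_eq_of_coe_eq {N K : C5.SmallLevel C.S.K₀} {γ γ' : C.G} (h : C5.HeckeLE γ N K) (h' : C5.HeckeLE γ' N K)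
    (hq : (γ : C.G ⧸ (K.1.1 : Subgroup C.G)) = γ') : T.albTr γ N K h = T.albTr γ' N K h' := by
  have hκ : γ⁻¹ * γ' ∈ K.1.1 := QuotientGroup.eq.1 hq
  have e1 : T.albTr γ' N K h' = T.albTr (γ * (γ⁻¹ * γ')) N K (h.mul (C5.HeckeLE.of_mem hκ)) :=
    T.albTr_congr (by rw [mul_inv_cancel_left]) _ _
  rw [e1, ← T.albTr_mul γ (γ⁻¹ * γ') h (C5.HeckeLE.of_mem hκ), T.albTr_self hκ, Category.comp_id]

end Sec42Data.HeckeTranslates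

namespace C5.SmallLevel

variable {H : Type} [Group H] [TopologicalSpace H] [IsTopologicalGroup H] {K₀ : OpenCompactSubgroup H}

/-- A finite family of levels has a common refinement inside a given level `K`. [cite: Liu2021, §4.2 (FJcycle.tex l. 2060–2072)] -/
theorem exists_le_forall_le {ι : Type*} (s : Finset ι) (L : ι → SmallLevel K₀) (K : SmallLevel K₀) :
    ∃ M : SmallLevel K₀, M ≤ K ∧ ∀ i ∈ s, M ≤ L i := by
  classical
  induction s using Finset.induction_on with
  | empty => exact ⟨K, le_rfl, fun i hi => absurd hi (Finset.notMem_empty i)⟩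
  | insert j s hj ih =>
    obtain ⟨M, hMK, hM⟩ := ih
    obtain ⟨M', hM'M, hM'j⟩ := exists_le_le M (L j)
    refine ⟨M', hM'M.trans hMK, fun i hi => ?_⟩
    rcases Finset.mem_insert.1 hi with rfl | hi
    · exact hM'j
    · exact hM'M.trans (hM i hi)

/-- **A common admissible normal source for the translates `T_γ`, `γK ⊆ KgK`**: for a finite set `s` of group elements there is a level
`N ⊆ K`, normalised by `K`, with `γ⁻¹Nγ ⊆ K` for every `γ ∈ s` (refine below the conjugate levels `γKγ⁻¹ ∩ K₀`, then normalise).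
[cite: Milne2005ShimuraVarieties, §13 p. 118 L21–26] [cite: Liu2021, §4.2 (FJcycle.tex l. 2060–2074)] -/
theorem exists_normal_le_forall_heckeLE (s : Finset H) (K : SmallLevel K₀) :
    ∃ N : SmallLevel K₀, N ≤ K ∧ (∀ k ∈ K.1.1, HeckeLE k N N) ∧ ∀ γ ∈ s, HeckeLE γ N K := by
  obtain ⟨M, hMK, hM⟩ := exists_le_forall_le s (fun γ => heckeLevel γ K) K
  obtain ⟨N, hNK, hNM, hN⟩ := exists_normal_le K M
  exact ⟨N, hNK, hN, fun γ hγ => (heckeLE_heckeLevel γ K).of_le_left (hNM.trans (hM γ hγ))⟩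

end C5.SmallLevel

/-! ## §2 The Hecke operator `[KgK]` at level `K` is `m⁻¹ ψ^*` for an honest endomorphism `ψ` of `A_K` -/

namespace Sec42Data.BettiPinning

variable {C : Sec42Data P5 isotropicAt} {T : C.HeckeTranslates} {τ' : E →+* ℂ} {H : Type} [AddCommGroup H] [Module ℂ H]
  {rhoB : Representation ℂ C.G H} (B : C.BettiPinning T τ' H rhoB)

/-- The double cosets `KgK` of a sufficiently small level are finite unions of left cosets (`K` is compact open in `𝔾(𝔸_F^∞)`).
[cite: Bump1997, §4.2 (Prop. 4.2.3, proof)] -/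
theorem finite_orbit_level (K : C5.SmallLevel C.S.K₀) (g : C.G) :
    (orbit K.1.1 (g : C.G ⧸ (K.1.1 : Subgroup C.G))).Finite := by
  haveI := Literature.NumberTheory.Automorphic.isHeckeTriple_top_of_isCompact_isOpen (K.1.1 : Subgroup C.G) K.1.2.2 K.1.2.1
  exact Literature.NumberTheory.Automorphic.finite_orbit_quotient (K.1.1 : Subgroup C.G) g

/-- **The Hecke operator `[KgK]` on `H^K` is the pull-back of an honest endomorphism of `A_K`, up to a non-zero integer** — granted
descent up to isogeny (row (D)): for every small level `K` and every `g` there are `m ≠ 0` and `ψ : A_K ⟶ A_K` with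
`b_K (ψ^* y) = m • [KgK] (b_K y)` for all level-`K` classes `y`.  Proof: pick `N ⊆ K` normalised by `K` with `γ⁻¹Nγ ⊆ K` for a transversal
`γ` of `KgK/K` (`exists_normal_le_forall_heckeLE`); the homomorphism `Φ := Σ_γ Alb(T_γ) : A_N → A_K` is `K`-invariant (`Alb T_k ≫ Alb T_γ =
Alb T_{kγ}` and `k` permutes `KgK/K`); (D) gives `Alb_{u^N_K} ≫ ψ = m • Φ`; and `b_N ((Alb T_γ)^* y) = rhoB γ (b_K y)` (the pinning's Hecke
law) sums to `[KgK] (b_K y)` while `b_N ∘ Alb_u^* = b_K`.  This is «the Hecke correspondences provide a homomorphism `𝔾(𝔸_F^∞) → Aut_E(A_∞)`»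
(l. 2074) read at a finite level. [cite: Liu2021, §4.2 (FJcycle.tex l. 2074) and Thm. 4.18 (1) proof (l. 2274–2282)] [cite: Bump1997, §4.2 (Prop. 4.2.3, proof)] -/
theorem exists_hom_b_bettiPullAlong_eq_smul_heckeOperator (hD : T.IsogenyDescent) (K : C5.SmallLevel C.S.K₀) (g : C.G) :
    ∃ (m : ℤ) (ψ : C.A K ⟶ C.A K), m ≠ 0 ∧ ∀ y : C.bettiH1 τ' K,
      B.b K (bettiPullAlong τ' ψ y) =
        (m : ℂ) • Literature.NumberTheory.Automorphic.heckeOperator rhoB (K.1.1 : Subgroup C.G) g (B.b K y) := by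
  classical
  -- the finite set of cosets `γK ⊆ KgK` and representatives
  have hfin := finite_orbit_level K g
  haveI : Fintype (orbit K.1.1 (g : C.G ⧸ (K.1.1 : Subgroup C.G))) := hfin.fintype
  let rep : orbit K.1.1 (g : C.G ⧸ (K.1.1 : Subgroup C.G)) → C.G := fun α => (α.1).out
  -- a common admissible normal source level
  obtain ⟨N, hNK, hN, hγ⟩ := C5.SmallLevel.exists_normal_le_forall_heckeLE (Finset.univ.image rep) K
  have hrep : ∀ α, C5.HeckeLE (rep α) N K := fun α => hγ _ (Finset.mem_image_of_mem rep (Finset.mem_univ α))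
  -- the translates as a function on the cosets, and their sum
  let a : orbit K.1.1 (g : C.G ⧸ (K.1.1 : Subgroup C.G)) → (C.A N ⟶ C.A K) := fun α => T.albTr (rep α) N K (hrep α)
  have hka : ∀ (k : C.G) (hk : k ∈ K.1.1) (α : orbit K.1.1 (g : C.G ⧸ (K.1.1 : Subgroup C.G))),
      T.albTr k N N (hN k hk) ≫ a α = a ((⟨k, hk⟩ : K.1.1) • α) := by
    intro k hk α
    rw [T.albTr_mul k (rep α) (hN k hk) (hrep α)]
    refine T.albTr_eq_of_coe_eq _ _ ?_
    -- `(k * rep α) K = (k • α)` and `rep (k • α)` represents `k • α`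
    have h1 : ((k * rep α : C.G) : C.G ⧸ (K.1.1 : Subgroup C.G)) = ((⟨k, hk⟩ : K.1.1) • α : orbit K.1.1 _).1 := by
      rw [orbit.coe_smul, ← QuotientGroup.out_eq' α.1]
      rfl
    rw [h1]
    exact (QuotientGroup.out_eq' _).symm
  let Φ : C.A N ⟶ C.A K := ∑ α, a α
  have hΦ : ∀ (k : C.G) (hk : k ∈ K.1.1), T.albTr k N N (hN k hk) ≫ Φ = Φ := by
    intro k hk
    show T.albTr k N N (hN k hk) ≫ ∑ α, a α = ∑ α, a α
    rw [Preadditive.comp_sum]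
    exact (Finset.sum_congr rfl fun α _ => hka k hk α).trans (Equiv.sum_comp (MulAction.toPerm (⟨k, hk⟩ : K.1.1)) a)
  -- descent up to isogeny
  obtain ⟨m, ψ, hm, hψ⟩ := hD hNK hN (C.A K) Φ hΦ
  refine ⟨m, ψ, hm, fun y => ?_⟩
  -- read `Alb_u ≫ ψ = m • Φ` on `H¹` and push through the pinning
  have h1 : B.b K (bettiPullAlong τ' ψ y) = B.b N (bettiPullAlong τ' (C.Atr (homOfLE hNK) ≫ ψ) y) := by
    rw [bettiPullAlong_comp_apply, B.b_bettiPullAlong_Atr]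
  have h2 : bettiPullAlong τ' (C.Atr (homOfLE hNK) ≫ ψ) y = (m : ℂ) • ∑ α, bettiPullAlong τ' (a α) y := by
    rw [hψ, bettiPullAlong_zsmul, LinearMap.smul_apply, ← Int.cast_smul_eq_zsmul ℂ m]
    congr 1
    show bettiPullAlong τ' (∑ α, a α) y = _
    rw [bettiPullAlong_sum, LinearMap.sum_apply]
  have h3 : ∀ α, B.b N (bettiPullAlong τ' (a α) y) = rhoB (rep α) (B.b K y) := fun α =>
    (B.b_hecke (rep α) N K (hrep α) y).symm
  rw [h1, h2, map_smul, map_sum]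
  simp_rw [h3]
  congr 1
  -- the sum over the cosets is the Hecke operator
  rw [Literature.NumberTheory.Automorphic.heckeOperator_apply_eq_sum_out rhoB (K.1.1 : Subgroup C.G) g hfin
    (B.b_mem_fixedPoints K y), ← Finset.sum_coe_sort hfin.toFinset]
  exact Fintype.sum_equiv (Equiv.subtypeEquivRight fun x => hfin.mem_toFinset.symm) _ _ fun α => rfl

end Sec42Data.BettiPinning

end Literature.NumberTheory.Automorphic.Liu2021.AppendixC

end
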